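import Literature.NumberTheory.GaloisRepresentations.PicardTateModuleEisenstein
import Literature.NumberTheory.GaloisRepresentations.AugmentationStandardBasis
import HarnessLib

/-!
# The reduction of `T₃ J(C_f)` modulo `λ = 1 - ω` and a `ℤ₃[ω]`-basis adapted to `J[λ] ≅ (𝔽₃^{roots})⁰`

Topic `Literature/NumberTheory/GaloisRepresentations` (continues `PicardTateModuleEisenstein`).  For
`C_f : y³ = f(x)` over `K ∋ ζ₃` (`f` separable, `3 ∤ deg f`) with Tate module
`T = T₃ Pic(C_{f,K̄})`, a `ℤ₃[ω]`-module via `ω ↦ δ` (`tateModulePadicEisenstein`), the map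
`θ = (1 - δ) ∘ (t ↦ t mod 3) : T → Pic` (written `(lamAddMonoidHom hζ).comp (TateModule.proj 3 1)`)
identifies `T/λT` with `J[λ] = geomLambdaTorsion` `Γ_K`-equivariantly:

* `lamAddMonoidHom_lamAddMonoidHom_eq_zero` (`(1-δ)² = 0` on `Pic[3]`), `comp_proj_mem_geomLambdaTorsion`
  (`θ(T) ⊆ J[λ]`), `comp_proj_smul` (equivariance), `comp_proj_lam_smul` (`θ(λT) = 0`);
* under the counts `#Pic[3ⁿ] = 3^{2rn}`, `#J[λ] = 3^r`: `map_lamAddMonoidHom_torsionBy_eq`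
  (`(1-δ)Pic[3] = J[λ]`), `comp_proj_surjective` (`θ` onto `J[λ]`),
  `exists_eq_lam_smul_of_comp_proj_eq_zero` (`ker θ = λT`), `exists_eq_sum_add_lam_smul`;
* **`picard_exists_basis_repr_smul_congr`** — for the Picard curve (`f ∈ ℤ[X]` a separable quartic,
  `K ⊇ ℚ(ω)`, given `#J_f[3ⁿ] = 3^{6n}`): a root `r₀` and a `ℤ₃[ω]`-basis `b` of `T₃ J(C_f)` indexed by
  the other three roots such that the matrix of every `γ ∈ Γ_K` in `b` is congruent modulo `λ` to the
  integer matrix `C(γ) = ([γ x = y] - [γ r₀ = y])_{y,x}` (`augStdMatrix`) of `γ` on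
  `(𝔽₃^{roots})⁰` in its standard basis `e_x - e_{r₀}` — i.e. the residual representation of the
  `λ`-adic representation of the Picard curve is `(𝔽₃^{roots})⁰` (Upton 2009 §3; Schaefer 1998;
  Zarhin 2018 §8 (i)).

Everything is proved (no definitions, no named facts); the torsion count enters as the hypothesis
`hcard`.

## References
* C. Upton, *Galois representations attached to Picard curves*, J. Algebra 322 (2009), §3. [Upton2009]
* Yu. G. Zarhin, arXiv:1706.00110, §8. [Zarhin2018SuperellipticJacobians]
* E. F. Schaefer, Math. Ann. 310 (1998), §3. [Schaefer1998]
-/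

noncomputable section

open Polynomial

/-! ## The reduction of `T₃ J(C_f)` modulo `λ`: `T/λT ≅ J[λ]` and a `ℤ₃[ω]`-basis adapted to it -/

namespace Literature.NumberTheory.GaloisRepresentations

open Literature.NumberTheory.EllipticCurves SuperellipticFunctionField
open scoped Pointwise

universe u

section LambdaReduction

variable {K : Type u} [Field K] {f : K[X]}
  [Fact (Irreducible (superellipticPoly K (AlgebraicClosure K) 3 f))] {ζ : K}

/-- `(1 - δ)² = 0` on `Pic[3]` (`3 ∤ deg f`): `(1 - δ)² x = (1 + δ + δ²) x - 3 δ x = 0`. [folklore] -/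
theorem lamAddMonoidHom_lamAddMonoidHom_eq_zero (hζ : IsPrimitiveRoot ζ 3) (hsep : f.Separable)
    (hndvd : ¬ 3 ∣ f.natDegree) {x : GeomPic K 3 f} (hx : x ∈ AddSubgroup.torsionBy (GeomPic K 3 f) (3 : ℕ)) :
    lamAddMonoidHom hζ (lamAddMonoidHom hζ x) = 0 := by
  have h3 : (3 : ℕ) • x = 0 := AddSubgroup.torsionBy.nsmul_iff.1 hx
  have hdeg : SuperellipticPic.degree K (AlgebraicClosure K) 3 f x = 0 :=
    jacobianTorsion_le_degreeZero K (AlgebraicClosure K) 3 f three_ne_zero hx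
  have hnorm := sum_deck_pow_smul_eq_zero_of_degree_eq_zero (K := K) (isPrimitiveRoot_algebraMap_algebraicClosure hζ)
    hsep hndvd hdeg
  rw [Finset.sum_range_succ, Finset.sum_range_succ, Finset.sum_range_one, pow_zero, one_smul, pow_one, sq,
    mul_smul] at hnorm
  change x + deckGen hζ • x + deckGen hζ • (deckGen hζ • x) = 0 at hnorm
  rw [lamAddMonoidHom_apply, lamAddMonoidHom_apply, smul_sub]
  -- `(x - δx) - δ(x - δx) = x - 2δx + δ²x = (x + δx + δ²x) - 3 δx`
  have h3δ : (3 : ℕ) • (deckGen hζ • x) = 0 := by rw [smul_comm, h3, smul_zero]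
  have key : x - deckGen hζ • x - (deckGen hζ • x - deckGen hζ • (deckGen hζ • x)) =
      (x + deckGen hζ • x + deckGen hζ • (deckGen hζ • x)) - (3 : ℕ) • (deckGen hζ • x) := by
    rw [succ_nsmul, two_nsmul]; abel
  rw [key, hnorm, h3δ, sub_zero]

/-- `θ(T) ⊆ J[λ]`. [cite: Zarhin2018SuperellipticJacobians, §8] -/
theorem comp_proj_mem_geomLambdaTorsion (hζ : IsPrimitiveRoot ζ 3) (hsep : f.Separable) (hndvd : ¬ 3 ∣ f.natDegree)
    (t : TateModule (GeomPic K 3 f) 3) : ((lamAddMonoidHom hζ).comp (TateModule.proj 3 1)) t ∈ geomLambdaTorsion K 3 f := by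
  have hmem : TateModule.proj 3 1 t ∈ AddSubgroup.torsionBy (GeomPic K 3 f) (3 : ℕ) := by
    simpa [pow_one] using TateModule.proj_mem_torsionBy 1 t
  rw [mem_geomLambdaTorsion_iff hζ hsep hndvd, AddMonoidHom.comp_apply]
  refine ⟨?_, lamAddMonoidHom_lamAddMonoidHom_eq_zero hζ hsep hndvd hmem⟩
  have hx' : (3 : ℕ) • TateModule.proj 3 1 t = 0 := AddSubgroup.torsionBy.nsmul_iff.1 hmem
  refine AddSubgroup.torsionBy.nsmul_iff.2 ?_
  rw [lamAddMonoidHom_apply, smul_sub, smul_comm, hx', smul_zero, sub_zero]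

/-- `θ` is `Γ_K`-equivariant (`ζ₃ ∈ K`). [cite: Zarhin2018SuperellipticJacobians, §8] -/
theorem comp_proj_smul (hζ : IsPrimitiveRoot ζ 3) (σ : Field.absoluteGaloisGroup K) (t : TateModule (GeomPic K 3 f) 3) :
    ((lamAddMonoidHom hζ).comp (TateModule.proj 3 1)) (σ • t) = σ • ((lamAddMonoidHom hζ).comp (TateModule.proj 3 1)) t := by
  rw [AddMonoidHom.comp_apply, AddMonoidHom.comp_apply, TateModule.proj_smul_of_distribMulAction, lamAddMonoidHom_apply,
    lamAddMonoidHom_apply, smul_sub, absoluteGaloisGroup_smul_deck_smul K 3 f ⟨ζ, hζ⟩]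

/-- `θ(λ • s) = 0`. [folklore] -/
theorem comp_proj_lam_smul (hζ : IsPrimitiveRoot ζ 3) (hsep : f.Separable) (hndvd : ¬ 3 ∣ f.natDegree)
    (s : TateModule (GeomPic K 3 f) 3) :
    letI := tateModulePadicEisenstein f hζ hsep hndvd
    ((lamAddMonoidHom hζ).comp (TateModule.proj 3 1)) (PadicEisenstein.lam • s) = 0 := by
  letI := tateModulePadicEisenstein f hζ hsep hndvd
  rw [AddMonoidHom.comp_apply, proj_lam_smul hζ hsep hndvd]
  exact lamAddMonoidHom_lamAddMonoidHom_eq_zero hζ hsep hndvd (by simpa [pow_one] using TateModule.proj_mem_torsionBy 1 s)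

/-- **`(1 - δ) Pic[3] = J[λ]`** when `#Pic[3ⁿ] = 3^{2rn}` and `#J[λ] = 3^r`: `⊆` by `(1-δ)² = 0` on `Pic[3]`,
and both sides have `3^r` elements (`#Pic[3] = #J[λ] · #(1-δ)Pic[3]`). [cite: Zarhin2018SuperellipticJacobians, §8] -/
theorem map_lamAddMonoidHom_torsionBy_eq (hζ : IsPrimitiveRoot ζ 3) (hsep : f.Separable) (hndvd : ¬ 3 ∣ f.natDegree)
    {r : ℕ} (hcard : ∀ n, Nat.card (AddSubgroup.torsionBy (GeomPic K 3 f) (3 ^ n : ℕ)) = 3 ^ (2 * r * n))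
    (hlam : Nat.card (geomLambdaTorsion K 3 f) = 3 ^ r) :
    (AddSubgroup.torsionBy (GeomPic K 3 f) (3 : ℕ)).map (lamAddMonoidHom hζ) = geomLambdaTorsion K 3 f := by
  classical
  set A₃ : AddSubgroup (GeomPic K 3 f) := AddSubgroup.torsionBy (GeomPic K 3 f) (3 : ℕ) with hA₃
  set Λ₀ : AddSubgroup (GeomPic K 3 f) := A₃.map (lamAddMonoidHom hζ) with hΛ₀
  -- `Λ₀ ≤ J[λ]`
  have hle0 : Λ₀ ≤ geomLambdaTorsion K 3 f := by
    rintro _ ⟨x, hx, rfl⟩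
    rw [mem_geomLambdaTorsion_iff hζ hsep hndvd]
    have hx' : (3 : ℕ) • x = 0 := AddSubgroup.torsionBy.nsmul_iff.1 hx
    refine ⟨AddSubgroup.torsionBy.nsmul_iff.2 ?_, lamAddMonoidHom_lamAddMonoidHom_eq_zero hζ hsep hndvd hx⟩
    rw [lamAddMonoidHom_apply, smul_sub, smul_comm, hx', smul_zero, sub_zero]
  -- cards: `#J[λ] · #Λ₀ = #A₃ = 3^{2r}`, so `#Λ₀ = 3^r = #J[λ]`
  have hle : geomLambdaTorsion K 3 f ≤ A₃ := fun x hx => ((mem_geomLambdaTorsion_iff hζ hsep hndvd x).1 hx).1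
  have h2 : Nat.card (geomLambdaTorsion K 3 f) * Nat.card Λ₀ = Nat.card A₃ := by
    have hr : ((lamAddMonoidHom hζ).comp A₃.subtype).range = Λ₀ := by
      rw [← AddMonoidHom.map_range, AddSubgroup.range_subtype]
    have hk : ((lamAddMonoidHom hζ).comp A₃.subtype).ker = (geomLambdaTorsion K 3 f).addSubgroupOf A₃ := by
      ext ⟨x, hx⟩
      rw [AddMonoidHom.mem_ker, AddSubgroup.mem_addSubgroupOf, AddMonoidHom.comp_apply, AddSubgroup.coe_subtype,
        mem_geomLambdaTorsion_iff hζ hsep hndvd]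
      exact ⟨fun h => ⟨hx, h⟩, fun h => h.2⟩
    rw [← hr, ← AddSubgroup.index_ker, hk, ← Nat.card_congr (AddSubgroup.addSubgroupOfEquivOfLe hle).toEquiv,
      AddSubgroup.card_mul_index]
  have hA₃ : Nat.card A₃ = 3 ^ (2 * r) := by
    have h := hcard 1
    rwa [pow_one, mul_one] at h
  rw [hA₃, hlam, two_mul, pow_add] at h2
  have hΛcard : Nat.card Λ₀ = 3 ^ r := Nat.eq_of_mul_eq_mul_left (pow_pos three_pos r) h2
  -- finite, so `≤` with equal cards is `=`
  haveI : Finite (geomLambdaTorsion K 3 f) := Nat.finite_of_card_ne_zero (by rw [hlam]; positivity)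
  exact AddSubgroup.eq_of_le_of_card_ge hle0 (by rw [hΛcard, hlam])

/-- **`θ : T₃ Pic → J[λ]` is onto** (under the counts): `J[λ] = (1-δ)Pic[3]` and `T → Pic[3]` is onto.
[cite: Zarhin2018SuperellipticJacobians, §8] -/
theorem comp_proj_surjective (hζ : IsPrimitiveRoot ζ 3) (hsep : f.Separable) (hndvd : ¬ 3 ∣ f.natDegree)
    {r : ℕ} (hcard : ∀ n, Nat.card (AddSubgroup.torsionBy (GeomPic K 3 f) (3 ^ n : ℕ)) = 3 ^ (2 * r * n))
    (hlam : Nat.card (geomLambdaTorsion K 3 f) = 3 ^ r) {y : GeomPic K 3 f} (hy : y ∈ geomLambdaTorsion K 3 f) :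
    ∃ t : TateModule (GeomPic K 3 f) 3, ((lamAddMonoidHom hζ).comp (TateModule.proj 3 1)) t = y := by
  rw [← map_lamAddMonoidHom_torsionBy_eq hζ hsep hndvd hcard hlam] at hy
  obtain ⟨x, hx, rfl⟩ := hy
  have hx1 : x ∈ AddSubgroup.torsionBy (GeomPic K 3 f) (3 ^ 1 : ℕ) := by rwa [pow_one]
  obtain ⟨b, hb⟩ := TateModule.proj_surjective_of_card hcard 1 hx1
  exact ⟨b, by rw [AddMonoidHom.comp_apply, hb]⟩

/-- **`ker θ = λT`**: if `(1-δ)(t mod 3) = 0` then `t mod 3 ∈ J[λ] = (1-δ)Pic[3]`, so `t ≡ λ b (mod 3T)` and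
`3T ⊆ λT`. [cite: Zarhin2018SuperellipticJacobians, §8] -/
theorem exists_eq_lam_smul_of_comp_proj_eq_zero (hζ : IsPrimitiveRoot ζ 3) (hsep : f.Separable)
    (hndvd : ¬ 3 ∣ f.natDegree) {r : ℕ}
    (hcard : ∀ n, Nat.card (AddSubgroup.torsionBy (GeomPic K 3 f) (3 ^ n : ℕ)) = 3 ^ (2 * r * n))
    (hlam : Nat.card (geomLambdaTorsion K 3 f) = 3 ^ r) {t : TateModule (GeomPic K 3 f) 3} (ht : ((lamAddMonoidHom hζ).comp (TateModule.proj 3 1)) t = 0) :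
    letI := tateModulePadicEisenstein f hζ hsep hndvd
    ∃ s : TateModule (GeomPic K 3 f) 3, t = PadicEisenstein.lam • s := by
  letI := tateModulePadicEisenstein f hζ hsep hndvd
  haveI := isScalarTower_tateModule hζ hsep hndvd
  have hmem : TateModule.proj 3 1 t ∈ geomLambdaTorsion K 3 f := by
    rw [mem_geomLambdaTorsion_iff hζ hsep hndvd]
    exact ⟨by simpa [pow_one] using TateModule.proj_mem_torsionBy 1 t, ht⟩
  rw [← map_lamAddMonoidHom_torsionBy_eq hζ hsep hndvd hcard hlam] at hmem
  obtain ⟨x, hx, hxt⟩ := hmem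
  have hx1 : x ∈ AddSubgroup.torsionBy (GeomPic K 3 f) (3 ^ 1 : ℕ) := by rwa [pow_one]
  obtain ⟨b, hb⟩ := TateModule.proj_surjective_of_card hcard 1 hx1
  have h0 : TateModule.proj 3 1 (t - PadicEisenstein.lam • b) = 0 := by
    rw [map_sub, proj_lam_smul, hb, hxt, sub_self]
  refine ⟨b + PadicEisenstein.lam • (-(PadicEisenstein.omega ^ 2) • TateModule.div (t - PadicEisenstein.lam • b) h0), ?_⟩
  rw [smul_add, ← PadicEisenstein.three_smul_eq, show (3 : ℤ_[3]) = ((3 : ℕ) : ℤ_[3]) by norm_num,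
    TateModule.p_smul_div, add_sub_cancel]

/-- **The span criterion for lifts**: if `θ(x) = θ(Σ cᵢ tᵢ)` then `x = Σ cᵢ tᵢ + λ s`. [folklore] -/
theorem exists_eq_sum_add_lam_smul (hζ : IsPrimitiveRoot ζ 3) (hsep : f.Separable) (hndvd : ¬ 3 ∣ f.natDegree)
    {r : ℕ} (hcard : ∀ n, Nat.card (AddSubgroup.torsionBy (GeomPic K 3 f) (3 ^ n : ℕ)) = 3 ^ (2 * r * n))
    (hlam : Nat.card (geomLambdaTorsion K 3 f) = 3 ^ r) {ι : Type*} [Fintype ι] (t : ι → TateModule (GeomPic K 3 f) 3)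
    (x : TateModule (GeomPic K 3 f) 3) (c : ι → ℤ) (hx : ((lamAddMonoidHom hζ).comp (TateModule.proj 3 1)) x = ∑ i, c i • ((lamAddMonoidHom hζ).comp (TateModule.proj 3 1)) (t i)) :
    letI := tateModulePadicEisenstein f hζ hsep hndvd
    ∃ s : TateModule (GeomPic K 3 f) 3, x = ∑ i, (c i : PadicEisenstein) • t i + PadicEisenstein.lam • s := by
  letI := tateModulePadicEisenstein f hζ hsep hndvd
  haveI := isScalarTower_tateModule hζ hsep hndvd
  have h0 : ((lamAddMonoidHom hζ).comp (TateModule.proj 3 1)) (x - ∑ i, (c i : PadicEisenstein) • t i) = 0 := by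
    rw [map_sub, map_sum, hx, sub_eq_zero]
    refine Finset.sum_congr rfl fun i _ => ?_
    rw [show ((c i : PadicEisenstein)) • t i = c i • t i by rw [Int.cast_smul_eq_zsmul], map_zsmul]
  obtain ⟨s, hs⟩ := exists_eq_lam_smul_of_comp_proj_eq_zero hζ hsep hndvd hcard hlam h0
  exact ⟨s, by rw [← hs, add_sub_cancel]⟩

end LambdaReduction

/-! ### The Picard curve: a `ℤ₃[ω]`-basis of `T₃ J(C_f)` reducing to the standard basis of `(𝔽₃^{roots})⁰` -/

section PicardResidual

variable (K : Type u) [Field K] [CharZero K] [IsCyclotomicExtension {3} ℚ K]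

open Classical in
/-- **A `ℤ₃[ω]`-basis of `T₃ J(C_f)` adapted to `J[1 - ω] ≅ (𝔽₃^{roots f})⁰`.**  For the Picard curve
`y³ = f(x)` over `K ⊇ ℚ(ω)` (given the torsion count `#J_f[3ⁿ] = 3^{6n}`), there are a root `r₀` of `f`
and a `ℤ₃[ω]`-basis `b` of `T = T₃ J(C_f)` indexed by the other three roots such that for every
`γ ∈ Γ_K` the matrix of `γ` in the basis `b` is congruent modulo `λ = 1 - ω` to the integer matrix
`C(γ)_{y,x} = [γ x = y] - [γ r₀ = y]` of `γ` permuting the roots (`augStdMatrix`).  Proof: `T/λT ≅ J[λ]`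
via `θ : t ↦ (1-δ)(t mod 3)` (onto with kernel `λT`), `J[λ] ≅ (𝔽₃^{roots})⁰` equivariantly
(`picard_lambdaTorsion_iso_heart`), lifts of the standard basis `e_x - e_{r₀}` form a `ℤ₃[ω]`-basis
(`PadicEisenstein.exists_basis_of_span`), and `γ (e_x - e_{r₀}) = Σ_y C(γ)_{y,x} (e_y - e_{r₀})`
(`augmentationRep_augStdMap`).  This is the residual representation `ρ̄ ≅ (𝔽₃^{roots})⁰` of the
`λ`-adic representation (Upton 2009 §3; Schaefer 1998; Zarhin 2018 §8 (i)).
[cite: Upton2009, §3] [cite: Zarhin2018SuperellipticJacobians, §8 (i) (arXiv p. 22)] -/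
theorem picard_exists_basis_repr_smul_congr (f : ℤ[X]) (h4 : f.natDegree = 4)
    (hsep : (f.map (Int.castRingHom ℚ)).Separable) {ζ : K} (hζ : IsPrimitiveRoot ζ 3)
    (hcard : haveI := fact_irreducible_superellipticPoly_picard K h4 hsep
      ∀ n, Nat.card (AddSubgroup.torsionBy (GeomPic K 3 (f.map (algebraMap ℤ K))) (3 ^ n : ℕ)) = 3 ^ (2 * 3 * n)) :
    haveI := fact_irreducible_superellipticPoly_picard K h4 hsep
    letI := tateModulePadicEisenstein (f.map (algebraMap ℤ K)) hζ (separable_map_algebraMap_int K hsep)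
      (not_three_dvd_natDegree_map K h4)
    ∃ (r₀ : (f.map (algebraMap ℤ K)).rootSet (AlgebraicClosure K))
      (b : Module.Basis {y : (f.map (algebraMap ℤ K)).rootSet (AlgebraicClosure K) // y ≠ r₀} PadicEisenstein
        (TateModule (GeomPic K 3 (f.map (algebraMap ℤ K))) 3)),
      ∀ (γ : Field.absoluteGaloisGroup K) (y x : {y : (f.map (algebraMap ℤ K)).rootSet (AlgebraicClosure K) // y ≠ r₀}),
        ∃ q : PadicEisenstein,
          b.repr (γ • b x) y = (augStdMatrix ℤ r₀ γ y x : PadicEisenstein) + PadicEisenstein.lam * q := by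
  haveI := fact_irreducible_superellipticPoly_picard K h4 hsep
  have hsepK : (f.map (algebraMap ℤ K)).Separable := separable_map_algebraMap_int K hsep
  have hndvd : ¬ 3 ∣ (f.map (algebraMap ℤ K)).natDegree := not_three_dvd_natDegree_map K h4
  letI := tateModulePadicEisenstein (f.map (algebraMap ℤ K)) hζ hsepK hndvd
  haveI := isScalarTower_tateModule hζ hsepK hndvd
  haveI := TateModule.free_of_card_torsionBy_rank hcard
  haveI := TateModule.finite_of_card_torsionBy_rank hcard
  have hlam : Nat.card (geomLambdaTorsion K 3 (f.map (algebraMap ℤ K))) = 3 ^ 3 :=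
    picard_card_geomLambdaTorsion K f h4 hsep
  -- roots: `#R = 4`, base point `r₀`, index set `ι = R ∖ {r₀}` of size `3`
  set R : Type u := ↥((f.map (algebraMap ℤ K)).rootSet (AlgebraicClosure K)) with hR
  have hR4 : Fintype.card R = 4 := card_rootSet_map_algebraMap_int K h4 hsep
  have hndvdR : ¬ 3 ∣ Fintype.card R := not_three_dvd_card_rootSet K h4 hsep
  obtain ⟨r₀⟩ : Nonempty R := Fintype.card_pos_iff.1 (by rw [hR4]; norm_num)
  have hι : Fintype.card {y : R // y ≠ r₀} = 3 := by
    rw [Fintype.card_subtype_compl, hR4, Fintype.card_subtype_eq]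
  have hrank : Module.finrank ℤ_[3] (TateModule (GeomPic K 3 (f.map (algebraMap ℤ K))) 3) =
      2 * Fintype.card {y : R // y ≠ r₀} := by
    rw [hι, TateModule.finrank_eq_of_card_torsionBy hcard]
  -- `J[λ] ≅ Heart ≅ (𝔽₃^R)⁰`, and the additive map `L : 𝔽₃^ι → Pic`, `e ↦ Ψ [Σ e_y (e_y - e_{r₀})]`
  obtain ⟨Ψ, -, hΨrange, hΨsmul⟩ := picard_lambdaTorsion_iso_heart K f h4 hsep
  set L : ({y : R // y ≠ r₀} → ZMod 3) →+ GeomPic K 3 (f.map (algebraMap ℤ K)) :=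
    Ψ.comp (((augmentationEquivHeart 3 R hndvdR).toLinearMap.comp (augStdMap (ZMod 3) r₀)).toAddMonoidHom) with hL
  have hL_apply : ∀ e, L e = Ψ (augmentationEquivHeart 3 R hndvdR (augStdMap (ZMod 3) r₀ e)) := fun e => rfl
  have hL_mem : ∀ e, L e ∈ geomLambdaTorsion K 3 (f.map (algebraMap ℤ K)) := fun e => by
    rw [← hΨrange]; exact ⟨_, rfl⟩
  have hL_int : ∀ n : {y : R // y ≠ r₀} → ℤ, L (fun y => (n y : ZMod 3)) = ∑ y, n y • L (Pi.single y 1) := by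
    intro n
    have hfun : (fun y => (n y : ZMod 3)) = ∑ y, n y • (Pi.single y (1 : ZMod 3) : {y : R // y ≠ r₀} → ZMod 3) := by
      funext y'
      rw [Finset.sum_apply, Finset.sum_eq_single y', Pi.smul_apply, Pi.single_eq_same, zsmul_one]
      · intro y _ hy
        rw [Pi.smul_apply, Pi.single_eq_of_ne hy.symm, smul_zero]
      · intro h; exact absurd (Finset.mem_univ _) h
    rw [hfun, map_sum]
    simp only [map_zsmul]
  -- lifts `t_y` of the standard vectors and the reduction `θ`
  have ht : ∀ y : {y : R // y ≠ r₀}, ∃ t : TateModule (GeomPic K 3 (f.map (algebraMap ℤ K))) 3,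
      ((lamAddMonoidHom hζ).comp (TateModule.proj 3 1)) t = L (Pi.single y 1) := fun y =>
    comp_proj_surjective hζ hsepK hndvd hcard hlam (hL_mem _)
  choose t ht using ht
  -- every `θ x` is an integer combination of the `θ t_y` : spanning modulo `λ`
  have hcomb : ∀ e : {y : R // y ≠ r₀} → ZMod 3, ∃ n : {y : R // y ≠ r₀} → ℤ,
      L e = ∑ y, n y • ((lamAddMonoidHom hζ).comp (TateModule.proj 3 1)) (t y) := by
    intro e
    refine ⟨fun y => ((e y).val : ℤ), ?_⟩
    have he : (fun y => (((e y).val : ℤ) : ZMod 3)) = e := by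
      funext y; rw [Int.cast_natCast, ZMod.natCast_zmod_val]
    conv_lhs => rw [← he]
    rw [hL_int]
    simp only [ht]
  have hspan : ∀ x : TateModule (GeomPic K 3 (f.map (algebraMap ℤ K))) 3,
      ∃ (c : {y : R // y ≠ r₀} → PadicEisenstein) (s : TateModule (GeomPic K 3 (f.map (algebraMap ℤ K))) 3),
        x = ∑ i, c i • t i + PadicEisenstein.lam • s := by
    intro x
    have hx : ((lamAddMonoidHom hζ).comp (TateModule.proj 3 1)) x ∈ geomLambdaTorsion K 3 (f.map (algebraMap ℤ K)) := comp_proj_mem_geomLambdaTorsion hζ hsepK hndvd x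
    rw [← hΨrange] at hx
    obtain ⟨h, hh⟩ := hx
    obtain ⟨e, he⟩ := augStdMap_surjective (ZMod 3) r₀ ((augmentationEquivHeart 3 R hndvdR).symm h)
    have hxL : ((lamAddMonoidHom hζ).comp (TateModule.proj 3 1)) x = L e := by
      rw [hL_apply, he, LinearEquiv.apply_symm_apply, hh]
    obtain ⟨n, hn⟩ := hcomb e
    obtain ⟨s, hs⟩ := exists_eq_sum_add_lam_smul hζ hsepK hndvd hcard hlam t x n (hxL.trans hn)
    exact ⟨fun y => (n y : PadicEisenstein), s, hs⟩
  obtain ⟨b, hb⟩ := PadicEisenstein.exists_basis_of_span hrank t hspan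
  refine ⟨r₀, b, fun γ y x => ?_⟩
  -- `θ(γ t_x) = γ θ(t_x) = Ψ[γ (e_x - e_{r₀})] = Σ_y C(γ)_{y,x} θ(t_y)`
  have hγ : ((lamAddMonoidHom hζ).comp (TateModule.proj 3 1)) (γ • t x) = ∑ y', (augStdMatrix ℤ r₀ γ y' x) • ((lamAddMonoidHom hζ).comp (TateModule.proj 3 1)) (t y') := by
    rw [comp_proj_smul, ht, hL_apply, ← hΨsmul, ← augmentationEquivHeart_augmentationRep,
      augmentationRep_augStdMap, Matrix.mulVec_single_one, ← hL_apply]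
    have hcol : (augStdMatrix (ZMod 3) r₀ γ).col x = fun y' => ((augStdMatrix ℤ r₀ γ y' x : ℤ) : ZMod 3) := by
      funext y'
      rw [Matrix.col_apply, ← augStdMatrix_map_intCast (ZMod 3) r₀ γ, Matrix.map_apply]
    rw [hcol, hL_int]
    simp only [ht]
  obtain ⟨s, hs⟩ := exists_eq_sum_add_lam_smul hζ hsepK hndvd hcard hlam t (γ • t x) _ hγ
  refine ⟨b.repr s y, ?_⟩
  rw [hb x, hs, map_add, map_sum, map_smul, Finsupp.add_apply, Finsupp.coe_finsetSum, Finset.sum_apply,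
    Finsupp.smul_apply, smul_eq_mul, Finset.sum_eq_single y]
  · rw [map_smul, ← hb y, b.repr_self, Finsupp.smul_apply, Finsupp.single_eq_same, smul_eq_mul, mul_one]
  · intro y' _ hy'
    rw [map_smul, ← hb y', b.repr_self, Finsupp.smul_apply, Finsupp.single_apply, if_neg hy', smul_zero]
  · intro h; exact absurd (Finset.mem_univ _) h

end PicardResidual

end Literature.NumberTheory.GaloisRepresentations
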